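import Summits.ABC.IUTFork.LDHGenuinePerImageSufficiencyWeighted
import Literature.IUT.HodgeTheaters.InitialThetaDataRootsOfUnityProofs
import Literature.IUT.LogVolume.GenuineThetaFieldCyclotomicRamification
import Literature.NumberTheory.NumberFields.SqrtNegOneZetaThreeDyadicIndices
import HarnessLib

/-!
# The fork at [IUTchIII] Corollary 3.12, L-DH level, READING (P): the ramification of `K = F(E_F[l])` over a `ℚ`-RATIONAL
# point, prime by prime (abc-iut cell, crux ThetaPartII = stmt-ABC-19678; row «C:PERIMAGE-DIFFSHARP», part 2 of 3)

Record-only PROOF file (D-0012) of the abc-iut cell (WAVE-3 discharge seat abc-iut-c312-d1, gen 9). TAKES NO SIDE on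
[IUTchIII] Cor. 3.12. For a genuine Θ-volume datum `T` of a rational point `q` (`F_tpd = ℚ`) and a prime `w` of `𝓞_K` over the
place `v ∋ p` of `ℚ`, the relative index `e(w ∣ v)` (Mathlib `Ideal.ramificationIdx'`, the quantity weighted in part 1's
`ndeg_differentDivisor_ge_weighted`) is divisible by:

* `dvd_ramificationIdx'_ratPoint_of_forall` — any `k` dividing the absolute index `e(x ∣ p)` of EVERY place `x` of `F` over `p`
  (tower `e(w ∣ v) = e(x ∣ v)·e(w ∣ x)`, `e(x ∣ v) = e(x ∣ p)` over a base of degree `1`); whence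
* `two_dvd_ramificationIdx'_ratPoint` — `2 ∣ e(w ∣ 2)` (`√−1 ∈ F`, [IUTchI] Def. 3.1 (a), `InitialThetaData.sqrt_neg_one_mem`;
  abc-iut-E-t47's `two_dvd_ramificationIdx_of_sq_eq_neg_one`);
* `sub_one_dvd_ramificationIdx'_ratPoint_of_dvd_thirty` — `(p − 1) ∣ e(w ∣ p)` for `p ∣ 30` (`μ₃₀ ⊂ F`: the `30`-torsion of
  `E_F` is `F`-rational, [IUTchIV] Thm. 1.10 p. 22, Weil pairing; abc-iut-W-neg-1's `sub_one_dvd_ramificationIdx_int`);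
* `sub_one_dvd_ramificationIdx'_ratPoint_l` — `(l − 1) ∣ e(w ∣ l)` (`μ_l ⊂ K`, abc-iut-s2-p4's
  `InitialThetaData.sub_one_dvd_ramIdx_mul_ramificationIdx'`);
* `l_dvd_ramificationIdx'_of_mem_badPlacesAvoid` (ANY point `P`) — `l ∣ e(w ∣ V)` at a pole `V ∤ 2l` of `j(λ)` (the divisibility
  form of abc-iut-S4's `l_le_ramificationIdx_of_mem_badPlacesAvoid`: [IUTchI] Def. 3.1 (c) + Ex. 3.2 (iv) at the place `x ∈ 𝕍(F)^bad`
  under `w`, the (P5) choice);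
* `div_gcd_thirty_dvd_ramificationIdx_F` — `(30/gcd(30, e_p)) ∣ e(x ∣ p)` for every place `x` of `F` over a pole `p` of
  `j(q) = N/∏_{p∈I} p^{e_p}` (abc-iut-W-num-2's `thirty_dvd_ramificationIdx_mul_ord`: the `30`-th root of the Tate parameter,
  Silverman ATAEC V.5.3 — no avoidance of `2l`, no oddness).

Classical; nothing here asserts the existence of Θ-data, Cor. 3.12 in general or in print's reading, or abc.
[cite: Mochizuki2012, IUTchI Def. 3.1 (a)(b)(c) p. 61–62, Ex. 3.2 (iv) p. 71; IUTchIV Thm. 1.10 p. 22, Cor. 2.2 (ii) proof (P5) p. 46]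
[cite: SilvermanAEC2009, Cor. III.8.1.1] [cite: SilvermanATAEC1994, V.5 Thm. 5.3] [cite: Washington1997, Lemma 1.4 and Prop. 2.1]
[cite: NeukirchANT1999, Ch. II Prop. (6.8)] [claim: Mochizuki2012, status: disputed] for every IUT quotation. PROOF-ONLY: no definitions,
no new `Prop`.
-/

noncomputable section

open NumberField IsDedekindDomain Ideal Module

namespace Literature.IUT.LogVolume.Cor22

open Literature.NumberTheory.DiophantineGeometry.GenEll Summit.ABC.IUTFork Literature.IUT.HodgeTheaters
open Literature.NumberTheory.NumberFields

/-! ## 4. At a `ℚ`-RATIONAL point: the divisibilities of `e(w ∣ v)` and the sharpened hypothesis-free test -/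

open Literature.NumberTheory.DiophantineGeometry.UniformABCConjecture Rat.HeightOneSpectrum

/-- `a ∣ E·b ⟹ (a / gcd(a, b)) ∣ E` in `ℕ`. [folklore] -/
private theorem div_gcd_dvd_of_dvd_mul {a b E : ℕ} (ha : 0 < a) (h : a ∣ E * b) : a / Nat.gcd a b ∣ E := by
  set g := Nat.gcd a b with hg
  have hg0 : 0 < g := Nat.gcd_pos_of_pos_left b ha
  obtain ⟨a', ha'⟩ : g ∣ a := Nat.gcd_dvd_left a b
  obtain ⟨b', hb'⟩ : g ∣ b := Nat.gcd_dvd_right a b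
  have hdiv : a / g = a' := by rw [ha', Nat.mul_div_cancel_left _ hg0]
  rw [hdiv]
  have hcop : Nat.Coprime a' b' := by
    have h1 : Nat.Coprime (a / g) (b / g) := Nat.coprime_div_gcd_div_gcd hg0
    rwa [hdiv, hb', Nat.mul_div_cancel_left _ hg0] at h1
  have h2 : a' ∣ E * b' := by
    rw [ha', hb'] at h
    have h3 : g * a' ∣ g * (E * b') := by
      have : E * (g * b') = g * (E * b') := by ring
      rwa [this] at h
    exact (Nat.mul_dvd_mul_iff_left hg0).mp h3
  exact hcop.dvd_of_dvd_mul_right h2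

/-- `e(v ∣ p) = 1` for a place `v` of a number field of degree `1` over `ℚ`. [folklore] -/
private theorem ramIdx_eq_one_of_finrank_eq_one {F₀ : Type} [Field F₀] [NumberField F₀]
    (hF₀ : Module.finrank ℚ F₀ = 1) (v : HeightOneSpectrum (𝓞 F₀)) : ramIdx F₀ v = 1 := by
  haveI : (v.asIdeal.under ℤ).IsMaximal := Ideal.IsMaximal.under ℤ v.asIdeal
  have h0 : v.asIdeal.under ℤ ≠ ⊥ := mt Ideal.eq_bot_of_comap_eq_bot v.ne_bot
  have hle : v.asIdeal.ramificationIdx ℤ ≤ Module.finrank ℚ F₀ := by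
    rw [← Ideal.ramificationIdx'_eq_ramificationIdx (v.asIdeal.under ℤ) v.asIdeal h0]
    exact Ideal.ramificationIdx_le_finrank (𝓞 F₀) ℚ F₀ v.asIdeal (p := v.asIdeal.under ℤ)
  rw [hF₀, ← ramIdx_eq] at hle
  have hne : ramIdx F₀ v ≠ 0 := ramIdx_ne_zero F₀ v
  omega

namespace ThetaVolumeDatumAt

variable {q : ℚ} {l : ℕ} (T : ThetaVolumeDatumAt (ratPoint q) l)

/-- **Tower bookkeeping at a rational datum.** For a place `v` of `F_tpd = ℚ` containing the prime `p` and a prime `w` of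
`𝓞_K` over `v`: if a natural number `k` divides the ABSOLUTE ramification index `e(x ∣ p)` of every place `x` of `F = T.F`
over `p`, then `k ∣ e(w ∣ v)` — since `e(w ∣ v) = e(x ∣ v)·e(w ∣ x)` for the place `x` of `F` under `w`
(Mathlib `ramificationIdx'_algebra_tower'`) and `e(x ∣ v) = e(x ∣ p)` over a base of degree `1`.
[cite: NeukirchANT1999, Ch. II Prop. (6.8)] -/
theorem dvd_ramificationIdx'_ratPoint_of_forall {p k : ℕ}
    (hk : letI := T.instFieldF; letI := T.instNumberFieldF
      ∀ x : HeightOneSpectrum (𝓞 T.F), ((p : ℕ) : 𝓞 T.F) ∈ x.asIdeal → k ∣ x.asIdeal.ramificationIdx ℤ) :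
    letI := T.instFieldF; letI := T.instNumberFieldF; letI := T.instAlgebraF; letI := T.instFieldK
    letI := T.instNumberFieldK; letI := T.instAlgebraK
    letI : Algebra (ratPoint q).F T.K := ((algebraMap T.F T.K).comp (algebraMap (ratPoint q).F T.F)).toAlgebra
    ∀ v : HeightOneSpectrum (𝓞 (ratPoint q).F), ((p : ℕ) : 𝓞 (ratPoint q).F) ∈ v.asIdeal →
      ∀ w ∈ IsDedekindDomain.primesOverFinset v.asIdeal (𝓞 T.K), k ∣ ramificationIdx' v.asIdeal w := by
  classical
  letI := T.instFieldF; letI := T.instNumberFieldF; letI := T.instAlgebraF; letI := T.instFieldK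
  letI := T.instNumberFieldK; letI := T.instAlgebraK
  letI : Algebra (ratPoint q).F T.K := ((algebraMap T.F T.K).comp (algebraMap (ratPoint q).F T.F)).toAlgebra
  haveI : IsScalarTower (ratPoint q).F T.F T.K := IsScalarTower.of_algebraMap_eq fun _ => rfl
  intro v hv w hw
  obtain ⟨hwP, hwL⟩ := (IsDedekindDomain.mem_primesOverFinset_iff v.ne_bot (𝓞 T.K)).mp hw
  have hwbot : w ≠ ⊥ := Ideal.ne_bot_of_mem_primesOver v.ne_bot
    ((IsDedekindDomain.mem_primesOverFinset_iff v.ne_bot (𝓞 T.K)).mp hw)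
  set w' : HeightOneSpectrum (𝓞 T.K) := ⟨w, hwP, hwbot⟩ with hw'
  -- the place of `F` under `w`
  set x : HeightOneSpectrum (𝓞 T.F) := w'.under (𝓞 T.F) with hx
  haveI hwx : w.LiesOver x.asIdeal := ⟨rfl⟩
  haveI : x.asIdeal.LiesOver v.asIdeal := by
    constructor
    rw [hx, HeightOneSpectrum.under_asIdeal, Ideal.under_under]
    exact hwL.over
  -- `p ∈ x`
  have hpw : ((p : ℕ) : 𝓞 T.K) ∈ w := by
    have h := Ideal.mem_comap.mp ((Ideal.LiesOver.over (P := w) (p := v.asIdeal)) ▸ hv :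
      ((p : ℕ) : 𝓞 (ratPoint q).F) ∈ w.under (𝓞 (ratPoint q).F))
    rwa [map_natCast] at h
  have hpx : ((p : ℕ) : 𝓞 T.F) ∈ x.asIdeal := by
    change ((p : ℕ) : 𝓞 T.F) ∈ w.comap (algebraMap (𝓞 T.F) (𝓞 T.K))
    rw [Ideal.mem_comap, map_natCast]
    exact hpw
  -- `e(x ∣ v) = e(x ∣ p)` (base of degree `1`)
  have hunder : x.under (𝓞 (ratPoint q).F) = v :=
    HeightOneSpectrum.ext (Ideal.LiesOver.over (P := x.asIdeal) (p := v.asIdeal)).symm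
  have hxv : ramificationIdx' v.asIdeal x.asIdeal = x.asIdeal.ramificationIdx ℤ := by
    have h := ThetaData.absRamificationIdx_eq_ramIdx_mul (F := (ratPoint q).F) x
    rw [ramIdx_eq_one_of_finrank_eq_one (degree_ratPoint q), one_mul, hunder] at h
    exact h.symm
  -- `e(w ∣ v) = e(x ∣ v)·e(w ∣ x)`
  have htower : ramificationIdx' v.asIdeal w = ramificationIdx' v.asIdeal x.asIdeal * ramificationIdx' x.asIdeal w :=
    Ideal.ramificationIdx'_algebra_tower' v.asIdeal x.asIdeal w
  rw [htower, hxv]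
  exact (hk x hpx).mul_right _

/-- **`2 ∣ e(w ∣ v)` over the place `v ∋ 2` of `ℚ`**, at every genuine Θ-volume datum of a rational point: `√−1 ∈ F`
([IUTchI] Def. 3.1 (a), `InitialThetaData.sqrt_neg_one_mem`) and §2. [cite: Mochizuki2012, IUTchI Def. 3.1 (a) p. 61]
[cite: Washington1997, Lemma 1.4 and Prop. 2.1] [claim: Mochizuki2012, status: disputed] -/
theorem two_dvd_ramificationIdx'_ratPoint :
    letI := T.instFieldF; letI := T.instNumberFieldF; letI := T.instAlgebraF; letI := T.instFieldK
    letI := T.instNumberFieldK; letI := T.instAlgebraK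
    letI : Algebra (ratPoint q).F T.K := ((algebraMap T.F T.K).comp (algebraMap (ratPoint q).F T.F)).toAlgebra
    ∀ v : HeightOneSpectrum (𝓞 (ratPoint q).F), ((2 : ℕ) : 𝓞 (ratPoint q).F) ∈ v.asIdeal →
      ∀ w ∈ IsDedekindDomain.primesOverFinset v.asIdeal (𝓞 T.K), 2 ∣ ramificationIdx' v.asIdeal w := by
  letI := T.instFieldF; letI := T.instNumberFieldF; letI := T.instAlgebraF; letI := T.instFieldK
  letI := T.instNumberFieldK; letI := T.instAlgebraK; letI := T.instFieldFbar; letI := T.instAlgebraFbar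
  letI := T.instAlgebraKFbar; letI := T.instIsElliptic
  refine T.dvd_ramificationIdx'_ratPoint_of_forall (p := 2) (k := 2) fun x hx => ?_
  obtain ⟨i, hi⟩ := T.D.sqrt_neg_one_mem
  exact two_dvd_ramificationIdx_of_sq_eq_neg_one hi x hx

/-- **`(p − 1) ∣ e(w ∣ v)` over the place `v ∋ p` of `ℚ` for a prime `p ∣ 30`** (`2 ∣ e(w∣3)`, `4 ∣ e(w∣5)`), at every
genuine Θ-volume datum of a rational point: `μ_p ⊂ F` by the rational `30`-torsion and the Weil pairing (abc-iut-W-neg-1's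
`sub_one_dvd_ramificationIdx_int`). [cite: Mochizuki2012, IUTchIV Thm. 1.10 p. 22] [cite: SilvermanAEC2009, Cor. III.8.1.1]
[cite: Washington1997, Lemma 1.4 and Prop. 2.1] [claim: Mochizuki2012, status: disputed] -/
theorem sub_one_dvd_ramificationIdx'_ratPoint_of_dvd_thirty {p : ℕ} (hp : p.Prime) (hp30 : p ∣ 30) :
    letI := T.instFieldF; letI := T.instNumberFieldF; letI := T.instAlgebraF; letI := T.instFieldK
    letI := T.instNumberFieldK; letI := T.instAlgebraK
    letI : Algebra (ratPoint q).F T.K := ((algebraMap T.F T.K).comp (algebraMap (ratPoint q).F T.F)).toAlgebra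
    ∀ v : HeightOneSpectrum (𝓞 (ratPoint q).F), ((p : ℕ) : 𝓞 (ratPoint q).F) ∈ v.asIdeal →
      ∀ w ∈ IsDedekindDomain.primesOverFinset v.asIdeal (𝓞 T.K), (p - 1) ∣ ramificationIdx' v.asIdeal w :=
  T.dvd_ramificationIdx'_ratPoint_of_forall (p := p) (k := p - 1) fun x hx => T.sub_one_dvd_ramificationIdx_int hp hp30 x hx

/-- **`(l − 1) ∣ e(w ∣ v)` over the place `v ∋ l` of `ℚ`**, at every genuine Θ-volume datum of a rational point and the
datum's prime `l`: `μ_l ⊂ K = F(E_F[l])` (abc-iut-s2-p4's `InitialThetaData.sub_one_dvd_ramIdx_mul_ramificationIdx'`) and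
`e(v ∣ l) = 1`. [cite: Mochizuki2012, IUTchI Def. 3.1 (c) p. 62] [cite: SilvermanAEC2009, Cor. III.8.1.1]
[claim: Mochizuki2012, status: disputed] -/
theorem sub_one_dvd_ramificationIdx'_ratPoint_l :
    letI := T.instFieldF; letI := T.instNumberFieldF; letI := T.instAlgebraF; letI := T.instFieldK
    letI := T.instNumberFieldK; letI := T.instAlgebraK
    letI : Algebra (ratPoint q).F T.K := ((algebraMap T.F T.K).comp (algebraMap (ratPoint q).F T.F)).toAlgebra
    ∀ v : HeightOneSpectrum (𝓞 (ratPoint q).F), ((l : ℕ) : 𝓞 (ratPoint q).F) ∈ v.asIdeal →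
      ∀ w ∈ IsDedekindDomain.primesOverFinset v.asIdeal (𝓞 T.K), (l - 1) ∣ ramificationIdx' v.asIdeal w := by
  letI := T.instFieldF; letI := T.instNumberFieldF; letI := T.instAlgebraF; letI := T.instFieldK
  letI := T.instNumberFieldK; letI := T.instAlgebraK; letI := T.instFieldFbar; letI := T.instAlgebraFbar
  letI := T.instAlgebraKFbar; letI := T.instIsElliptic
  letI : Algebra (ratPoint q).F T.K := ((algebraMap T.F T.K).comp (algebraMap (ratPoint q).F T.F)).toAlgebra
  intro v hv w hw
  have h := T.D.sub_one_dvd_ramIdx_mul_ramificationIdx' v hv hw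
  rwa [ramIdx_eq_one_of_finrank_eq_one (degree_ratPoint q), one_mul] at h

/-- **`l ∣ e(w ∣ V)` at every place `V ∈ 𝕍^bad_mod` of `F_tpd` (a pole of `j(λ)` away from `2l`)** — the divisibility form
of abc-iut-S4's `l_le_ramificationIdx_of_mem_badPlacesAvoid` (ANY point `P`, not only rational ones): the place `x` of `F`
under `w` is in `𝕍(F)^bad` by the (P5) choice, so `l ∣ e(w ∣ x)` ([IUTchI] Def. 3.1 (c) + Ex. 3.2 (iv), abc-iut-w5-d009's
`ThetaData.l_dvd_ramificationIdx_of_under_mem_VFbad`), and `e(w ∣ V) = e(x ∣ V)·e(w ∣ x)`.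
[cite: Mochizuki2012, IUTchI Def. 3.1 (b)(c) p. 61–62; Ex. 3.2 (iv) p. 71] [cite: Mochizuki2012, IUTchIV Cor. 2.2 (ii) proof (P5) p. 46]
[claim: Mochizuki2012, status: disputed] -/
theorem l_dvd_ramificationIdx'_of_mem_badPlacesAvoid {P : NFPoint} (T : ThetaVolumeDatumAt P l) :
    letI := T.instFieldF; letI := T.instNumberFieldF; letI := T.instAlgebraF; letI := T.instFieldK
    letI := T.instNumberFieldK; letI := T.instAlgebraK
    letI : Algebra P.F T.K := ((algebraMap T.F T.K).comp (algebraMap P.F T.F)).toAlgebra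
    ∀ V ∈ badPlacesAvoid P {2, l}, ∀ w ∈ IsDedekindDomain.primesOverFinset V.asIdeal (𝓞 T.K),
      l ∣ ramificationIdx' V.asIdeal w := by
  classical
  letI := T.instFieldF; letI := T.instNumberFieldF; letI := T.instAlgebraF; letI := T.instFieldK
  letI := T.instNumberFieldK; letI := T.instAlgebraK; letI := T.instFieldFbar; letI := T.instAlgebraFbar
  letI := T.instAlgebraKFbar; letI := T.instIsElliptic
  letI : Algebra P.F T.K := ((algebraMap T.F T.K).comp (algebraMap P.F T.F)).toAlgebra
  haveI : IsScalarTower P.F T.F T.K := IsScalarTower.of_algebraMap_eq fun _ => rfl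
  intro V hV w hw
  obtain ⟨hwP, hwL⟩ := (IsDedekindDomain.mem_primesOverFinset_iff V.ne_bot (𝓞 T.K)).mp hw
  have hwbot : w ≠ ⊥ := Ideal.ne_bot_of_mem_primesOver V.ne_bot
    ((IsDedekindDomain.mem_primesOverFinset_iff V.ne_bot (𝓞 T.K)).mp hw)
  set w' : HeightOneSpectrum (𝓞 T.K) := ⟨w, hwP, hwbot⟩ with hw'
  set x : HeightOneSpectrum (𝓞 T.F) := w'.under (𝓞 T.F) with hx
  haveI hwx : w.LiesOver x.asIdeal := ⟨rfl⟩
  haveI : x.asIdeal.LiesOver V.asIdeal := by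
    constructor
    rw [hx, HeightOneSpectrum.under_asIdeal, Ideal.under_under]
    exact hwL.over
  have hxV : finBelow P.F T.F x = V := by
    apply HeightOneSpectrum.ext
    show x.asIdeal.under (𝓞 P.F) = V.asIdeal
    exact (Ideal.LiesOver.over (p := V.asIdeal) (P := x.asIdeal)).symm
  have hVbad := hV
  unfold badPlacesAvoid at hVbad
  rw [Finset.mem_filter, mem_badPlaces_iff_ord_neg] at hVbad
  have hx2l : ∀ r ∈ ({2, l} : Finset ℕ), ((r : ℕ) : 𝓞 T.F) ∉ x.asIdeal := by
    intro r hr hmem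
    apply hVbad.2 r hr
    rw [← hxV]
    exact (natCast_mem_asIdeal_finBelow_iff (F := P.F) x r).mpr hmem
  have hordx : ord T.F x T.E.j < 0 := by
    rw [T.j_eq]
    exact (ord_algebraMap_neg_iff (F := P.F) x (jInv P.x)).mpr (hxV ▸ hVbad.1)
  have hmult : T.E.HasMultiplicativeReductionAt x :=
    hasMultiplicativeReductionAt_of_ord_j_neg T.E T.D.isSemistable hordx
  have hxbad : FinitePlace.mk x ∈ T.D.VFbad := by
    refine (T.isP5Choice (FinitePlace.mk x)).mpr ?_
    rw [FinitePlace.maximalIdeal_mk]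
    exact ⟨hx2l, hmult⟩
  have hl : l ∣ ramificationIdx' x.asIdeal w := by
    have h := ThetaData.l_dvd_ramificationIdx_of_under_mem_VFbad T.D (w := w') (by rw [← hx]; exact hxbad)
    rw [← hx] at h
    exact h
  have htower : ramificationIdx' V.asIdeal w = ramificationIdx' V.asIdeal x.asIdeal * ramificationIdx' x.asIdeal w :=
    Ideal.ramificationIdx'_algebra_tower' V.asIdeal x.asIdeal w
  rw [htower]
  exact hl.mul_left _

variable {N D : ℕ} {I : Finset ℕ} {e : ℕ → ℕ}

/-- **`(30/gcd(30, e_p)) ∣ e(x ∣ p)` for every place `x` of `F` over a pole `p ∈ I` of `j(q) = N/∏_{p∈I} p^{e_p}`** (`p ∤ N`),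
at every genuine Θ-volume datum of the rational point `q`: the place of `ℚ` under `x` is a pole of order `e_p` (the tree's
`ord_jInv_ratPoint_of_mem`), so `30 ∣ e(x ∣ p)·e_p` by the `30`-th root of the Tate parameter (abc-iut-W-num-2's
`thirty_dvd_ramificationIdx_mul_ord`, Silverman ATAEC V.5.3) — no oddness or avoidance of `2l` needed.
[cite: Mochizuki2012, IUTchIV Thm. 1.10 p. 22] [cite: SilvermanATAEC1994, V.5 Thm. 5.3] [claim: Mochizuki2012, status: disputed] -/
theorem div_gcd_thirty_dvd_ramificationIdx_F (hI : ∀ p ∈ I, p.Prime) (he : ∀ p ∈ I, e p ≠ 0)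
    (hD : D = ∏ p ∈ I, p ^ e p) (hj : jInv q = (N : ℚ) / (D : ℚ)) (hN : N ≠ 0) {p : ℕ} (hpI : p ∈ I) (hcop : ¬ p ∣ N)
    (x : letI := T.instFieldF; letI := T.instNumberFieldF; HeightOneSpectrum (𝓞 T.F))
    (hx : letI := T.instFieldF; letI := T.instNumberFieldF; ((p : ℕ) : 𝓞 T.F) ∈ x.asIdeal) :
    30 / Nat.gcd 30 (e p) ∣ (letI := T.instFieldF; letI := T.instNumberFieldF; x.asIdeal.ramificationIdx ℤ) := by
  letI := T.instFieldF; letI := T.instNumberFieldF; letI := T.instAlgebraF; letI := T.instIsElliptic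
  have hp := hI p hpI
  -- the place of `F_tpd = ℚ` under `x`, as a place of `ℚ` (world of the dictionary), is the place of `p`
  obtain ⟨vQ, hvQ⟩ : ∃ vQ : HeightOneSpectrum (𝓞 ℚ), vQ = finBelow (ratPoint q).F T.F x := ⟨_, rfl⟩
  have hpvQ : ((p : ℕ) : 𝓞 ℚ) ∈ vQ.asIdeal := by
    subst hvQ
    exact (natCast_mem_asIdeal_finBelow_iff (F := (ratPoint q).F) x p).mpr hx
  have hgen : natGenerator vQ = p := by
    have hdvd : natGenerator vQ ∣ p := (natCast_mem_asIdeal_iff vQ p).mp hpvQ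
    exact (Nat.prime_dvd_prime_iff_eq (prime_natGenerator vQ) hp).mp hdvd
  have hpI' : natGenerator vQ ∈ I := by rw [hgen]; exact hpI
  have hcop' : ¬ natGenerator vQ ∣ N := by rw [hgen]; exact hcop
  have hord : ord ℚ vQ (jInv q) = -(e p : ℤ) := by
    have h := ord_jInv_ratPoint_of_mem hI hD hj hN vQ hpI' hcop'
    rw [hgen] at h
    exact h
  have he0 : (0 : ℤ) < e p := by exact_mod_cast Nat.pos_of_ne_zero (he p hpI)
  -- back to the world of the point `ratPoint q`
  subst hvQ
  have hordA : ord (ratPoint q).F (finBelow (ratPoint q).F T.F x) (jInv (ratPoint q).x) = -(e p : ℤ) := hord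
  have hbad : finBelow (ratPoint q).F T.F x ∈ badPlaces (ratPoint q) :=
    (mem_badPlaces_iff_ord_neg (ratPoint q) (finBelow (ratPoint q).F T.F x)).2 (by rw [hordA]; linarith)
  have h30 := T.thirty_dvd_ramificationIdx_mul_ord x hbad
  rw [hordA, mul_neg, dvd_neg] at h30
  have h30' : 30 ∣ x.asIdeal.ramificationIdx (𝓞 (ratPoint q).F) * e p := by exact_mod_cast h30
  -- `e(x ∣ p) = e(x ∣ v)` over the degree-one base
  have habs : x.asIdeal.ramificationIdx ℤ = x.asIdeal.ramificationIdx (𝓞 (ratPoint q).F) := by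
    have h := ThetaData.absRamificationIdx_eq_ramIdx_mul (F := (ratPoint q).F) x
    rw [ramIdx_eq_one_of_finrank_eq_one (degree_ratPoint q), one_mul] at h
    rw [h]
    exact Ideal.ramificationIdx'_eq_ramificationIdx (finBelow (ratPoint q).F T.F x).asIdeal x.asIdeal
      (finBelow (ratPoint q).F T.F x).ne_bot
  rw [habs]
  exact div_gcd_dvd_of_dvd_mul (by norm_num) h30'

/-- `k ∣ e(w ∣ v) ⟹ k ≤ e(w ∣ v)` for a prime `w` of the datum's `𝓞_K` over a place `v` of `F_tpd` (`e(w ∣ v) ≠ 0`). [folklore] -/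
theorem le_ramificationIdx'_of_dvd {P : NFPoint} (T : ThetaVolumeDatumAt P l) :
    letI := T.instFieldF; letI := T.instNumberFieldF; letI := T.instAlgebraF; letI := T.instFieldK
    letI := T.instNumberFieldK; letI := T.instAlgebraK
    letI : Algebra P.F T.K := ((algebraMap T.F T.K).comp (algebraMap P.F T.F)).toAlgebra
    ∀ (v : HeightOneSpectrum (𝓞 P.F)) {w : Ideal (𝓞 T.K)},
      w ∈ IsDedekindDomain.primesOverFinset v.asIdeal (𝓞 T.K) →
      ∀ {k : ℕ}, k ∣ ramificationIdx' v.asIdeal w → k ≤ ramificationIdx' v.asIdeal w := by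
  letI := T.instFieldF; letI := T.instNumberFieldF; letI := T.instAlgebraF; letI := T.instFieldK
  letI := T.instNumberFieldK; letI := T.instAlgebraK
  letI : Algebra P.F T.K := ((algebraMap T.F T.K).comp (algebraMap P.F T.F)).toAlgebra
  intro v w hw k hk
  obtain ⟨hwP, hwL⟩ := (IsDedekindDomain.mem_primesOverFinset_iff v.ne_bot (𝓞 T.K)).mp hw
  haveI := hwP
  haveI := hwL
  exact Nat.le_of_dvd (Nat.pos_of_ne_zero (Ideal.IsDedekindDomain.ramificationIdx'_ne_zero_of_liesOver w v.ne_bot)) hk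

end ThetaVolumeDatumAt

end Literature.IUT.LogVolume.Cor22

end
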